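import Literature.NumberTheory.Automorphic.GKModulesSchur                       -- ★ `isGKSubmodule_eigenspace_of_comm`, `exists_eq_algebraMap_of_comm` (the admissible case)
import Literature.RingTheory.JacobsonRadical.AlgebrasOverLargeFields          -- ★ `linearIndependent_of_sub_algebraMap_mul_eq_one` (Amitsur's clearing of denominators)
import Literature.RepresentationTheory.BorelWallach2000.UpqCasimirTensor        -- ★ `upqCasimirOp`, `upqCasimirOp_commK`, `upqCasimirOp_comm𝔤`
import Literature.NumberTheory.Automorphic.GKModulesProofs                      -- ★ `isGKModule_harishChandra_holds`
import Literature.NumberTheory.Automorphic.UnitaryGlobalizationIrreducibleNoAdm -- ★ p829194 `IsUnitaryGlobalization.isIrreducibleGK_harishChandra`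
import Mathlib.Analysis.Complex.Cardinality
import Mathlib.FieldTheory.IsAlgClosed.Basic
import HarnessLib

/-!
# Dixmier's lemma: Schur's lemma for irreducible `(𝔤, K)`-modules WITHOUT admissibility

Topic `NumberTheory/Automorphic`; namespace `Literature.NumberTheory.Automorphic`; THEOREMS ONLY (no `def`, no named fact, no instance, no notation,
no `sorry`).  Cell `hodgecm-mathlib`, F0∕P3, T1a arch line: node **N0** of the in-house road to the letter V19 ★ `IrreducibleUnitaryKTypeGrowth`
([Varadarajan1989, §5.4 Thm. 19]; LEAD F0P3b-p01 (g2) 2026-08-31T17:59:55Z «N0 yours»): the Casimir element must act by a SCALAR on the Harish-Chandra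
module of a unitary globalization of an irreducible `(𝔤, K)`-class — where NO admissibility is available (it is what the road sets out to prove).  The tree's
Schur lemma ★ `exists_eq_algebraMap_of_comm` ([WallachRRG1, Lemma 3.3.2]) assumes `IsAdmissibleGK`; here the hypothesis is REMOVED, following Dixmier
([KnappVogan1995, Prop. A.12 (c) ∕ Prop. 4.87]; [WallachRRG1, 0.5.2]): an irreducible `(𝔤, K)`-module has COUNTABLE dimension, and an intertwining
operator on a space of dimension `< |ℂ|` over the algebraically closed field `ℂ` has an eigenvalue.

THE PROOF (Dixmier; Amitsur's trick as in [Lam2001FirstCourse, §4 (4.20)], whose Lean core is the tree's ★ `linearIndependent_of_sub_algebraMap_mul_eq_one`).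
§1 ONE OPERATOR.  `k` algebraically closed, `V ≠ 0` a `k`-space with `dim V < |k|`, `C ⊆ End V` the commutant of a set `s` all of whose NON-ZERO members are
BIJECTIVE (Schur's dichotomy, a hypothesis here), `θ ∈ C`.  If no `θ − c` (`c ∈ k`) has a kernel, each `θ − c ∈ C ∖ 0` is a unit; `θ` is then transcendental
(`p(θ) = a ∏ (θ − cᵢ)` would be a unit and zero), so the inverses `(θ − c)⁻¹`, `c ∈ k`, are `k`-linearly independent in the commutative subalgebra
`k[θ, (θ − c)⁻¹]` (Amitsur), hence in `End V`, hence — applied to a fixed `v₀ ≠ 0`, since their span lies in `C` whose non-zero members are injective — in `V`: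
`|k| ≤ dim V`, a contradiction.  So `θ` has an eigenvalue `c`, and `θ = c` if moreover `ker (θ − c)` is all of `V` (irreducibility).
§2 `(𝔤, K)`-MODULES.  Kernels and ranges of operators commuting with `ρK(K)` and `ρ𝔤(𝔤)` are `(𝔤, K)`-submodules, so on an IRREDUCIBLE module the commutant has
Schur's dichotomy; with `dim_ℂ V ≤ ℵ₀ < 𝔠 = |ℂ|` §1 applies: **`exists_eq_algebraMap_of_comm_of_rank_le_aleph0`**.
§3 COUNTABLE DIMENSION.  An irreducible `(𝔤, K)`-module (`dim 𝔤 < ∞`) is spanned by the countably many words `ρ𝔤(b_{i₁}) ⋯ ρ𝔤(b_{iₙ}) w` in a basis `(bᵢ)` of `𝔤`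
applied to a finite basis `(w)` of one `K`-orbit span (`K`-stability of that span by ★ `IsGKModule.ad_compat`, induction on the word length):
**`rank_le_aleph0_of_isIrreducibleGK`**.
§4 THE RESULTS: **`exists_eq_algebraMap_of_comm'`** = ★ `exists_eq_algebraMap_of_comm` with `hadm` DELETED; `existsUnique_forall_eq_smul_of_comm'`.
§5 READ-BACKS for `U(α, β)`: **`upqCasimirOp_eq_algebraMap_of_isIrreducibleGK`** (the Casimir ★ `upqCasimirOp` is a scalar on every irreducible
`(𝔤, K)`-module) and **`exists_upqCasimirOp_harishChandra_eq_smul`** (… on `H_K^∞` of any unitary globalization of an irreducible class; ★ p829194).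
UNIVERSES: the `(𝔤, K)`-modules of §2–§5 have carrier `V : Type` (as ★ `GKIrrep`, the Harish-Chandra spaces of `E : Type`); §1 is universe-polymorphic.
HONEST LABEL: pure algebra over the tree's `(𝔤, K)` currency; closes no registered stub by itself (it is node N0 of the V19 road).  HC_CM is proved only modulo
the 2 remaining named inputs (hLiu418, h413) — behind them the booked printed statements + the MOD package — until rung 0 closes.

## References
* A. W. Knapp, D. A. Vogan, *Cohomological Induction and Unitary Representations* (1995), Prop. A.12 (c), Prop. 4.87 (Dixmier's lemma) [KnappVogan1995].
* N. R. Wallach, *Real Reductive Groups I* (1988), 0.5.2, Lemma 3.3.2 [WallachRRG1].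
* T. Y. Lam, *A First Course in Noncommutative Rings*, 2nd ed. (2001), §4 Thm. (4.20) (Amitsur's trick) [Lam2001FirstCourse].
* V. S. Varadarajan, *An Introduction to Harmonic Analysis on Semisimple Lie Groups* (1989), §5.4 (quasi-simplicity) [Varadarajan1989].
-/

set_option autoImplicit false

noncomputable section

open scoped Cardinal
open Polynomial Cardinal

namespace Literature.NumberTheory.Automorphic

/-! ## §1 Dixmier's lemma for one operator in a Schur commutant -/

section Dixmier

universe uk uV

variable {k : Type uk} [Field k] {V : Type uV} [AddCommGroup V] [Module k V]

/-- In the commutant `C = Subalgebra.centralizer k s` of a set of operators: if `φ ∈ C` is a unit of `End V`, its inverse lies in `C`. [folklore]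
[cite: KnappVogan1995, Prop. A.12 (c)] -/
theorem units_inv_mem_centralizer {s : Set (Module.End k V)} (u : (Module.End k V)ˣ)
    (hu : (u : Module.End k V) ∈ Subalgebra.centralizer k s) : ((u⁻¹ : (Module.End k V)ˣ) : Module.End k V) ∈ Subalgebra.centralizer k s := by
  rw [Subalgebra.mem_centralizer_iff] at hu ⊢
  intro g hg
  exact (Commute.units_inv_right (u := u) (hu g hg)).eq

/-- If `θ − c·1` is a unit for every `c ∈ k` and `V ≠ 0`, then `θ` is transcendental over `k`: a relation `p(θ) = 0` with `p = a ∏ (X − cᵢ) ≠ 0`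
(`k` algebraically closed) would make the unit `∏ (θ − cᵢ)` vanish. [cite: Lam2001FirstCourse, §4 Thm. (4.20)] [cite: KnappVogan1995, Prop. A.12 (c)] -/
theorem transcendental_of_forall_isUnit_sub_algebraMap [IsAlgClosed k] [Nontrivial V] (θ : Module.End k V)
    (hθ : ∀ c : k, IsUnit (θ - algebraMap k (Module.End k V) c)) : Transcendental k θ := by
  intro halg
  obtain ⟨p, hp0, hp⟩ := halg
  -- `p = a · ∏ (X − cᵢ)`
  have hsplit := C_leadingCoeff_mul_prod_multiset_X_sub_C (IsAlgClosed.card_roots_eq_natDegree (p := p))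
  have ha : p.leadingCoeff ≠ 0 := leadingCoeff_ne_zero.mpr hp0
  -- `∏ (θ − cᵢ)` is a unit (induction on the multiset of roots; `End V` is not commutative, so no `map_multiset_prod`)
  have hunit_all : ∀ m : Multiset k, IsUnit (aeval θ ((m.map fun a => X - C a).prod)) := by
    intro m
    induction m using Multiset.induction_on with
    | empty => simp only [Multiset.map_zero, Multiset.prod_zero, map_one, isUnit_one]
    | cons a m ih =>
      rw [Multiset.map_cons, Multiset.prod_cons, map_mul]
      refine IsUnit.mul ?_ ih
      simp only [map_sub, aeval_X, aeval_C]
      exact hθ a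
  have hunit := hunit_all p.roots
  -- so `a • unit = 0`, i.e. the unit is `0`: `End V` is trivial
  have h0 : aeval θ (C p.leadingCoeff * (p.roots.map fun a => X - C a).prod) = 0 := by rw [hsplit, hp]
  rw [map_mul, aeval_C] at h0
  have hu0 : aeval θ ((p.roots.map fun a => X - C a).prod) = 0 := by
    have h1 := congrArg (fun T => algebraMap k (Module.End k V) p.leadingCoeff⁻¹ * T) h0
    simp only [mul_zero, ← mul_assoc, ← map_mul, inv_mul_cancel₀ ha, map_one, one_mul] at h1
    exact h1
  rw [hu0] at hunit
  exact not_isUnit_zero hunit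

/-- **DIXMIER'S LEMMA FOR ONE OPERATOR.**  Let `k` be algebraically closed, `V ≠ 0` a `k`-space with `dim_k V < |k|`, `s` a set of operators whose
commutant `C` has SCHUR'S DICHOTOMY (every non-zero `φ ∈ C` is bijective), and `θ ∈ C`.  Then `θ` has an eigenvalue.  (Otherwise all `θ − c` are units,
`θ` is transcendental, the `(θ − c)⁻¹ v₀`, `c ∈ k`, are linearly independent — Amitsur in `k[θ, (θ−c)⁻¹]` (★ `linearIndependent_of_sub_algebraMap_mul_eq_one`),
then injectivity of non-zero members of `C` on `v₀` — and `|k| ≤ dim V`.) [cite: KnappVogan1995, Prop. A.12 (c), Prop. 4.87]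
[cite: Lam2001FirstCourse, §4 Thm. (4.20)] -/
theorem exists_hasEigenvalue_of_mem_centralizer_of_rank_lt [IsAlgClosed k] [Nontrivial V]
    (hV : Cardinal.lift.{uk} (Module.rank k V) < Cardinal.lift.{uV} #k) {s : Set (Module.End k V)}
    (hS : ∀ φ ∈ Subalgebra.centralizer k s, φ ≠ 0 → Function.Bijective φ)
    {θ : Module.End k V} (hθ : θ ∈ Subalgebra.centralizer k s) : ∃ c : k, θ.HasEigenvalue c := by
  by_contra hne
  push Not at hne
  set C := Subalgebra.centralizer k s with hCdef
  -- every `θ − c` is a non-zero member of `C`, hence bijective, hence a unit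
  have hmem : ∀ c : k, θ - algebraMap k (Module.End k V) c ∈ C := fun c => C.sub_mem hθ (C.algebraMap_mem c)
  have hinj : ∀ c : k, Function.Injective (θ - algebraMap k (Module.End k V) c) := by
    intro c
    have h := hne c
    rw [Module.End.hasEigenvalue_iff, ne_eq, not_not, Module.End.eigenspace_def, ← Algebra.algebraMap_eq_smul_one] at h
    exact LinearMap.ker_eq_bot.mp h
  have hne0 : ∀ c : k, θ - algebraMap k (Module.End k V) c ≠ 0 := by
    intro c h0
    obtain ⟨v, hv⟩ := exists_ne (0 : V)
    exact hv (hinj c (by rw [h0, LinearMap.zero_apply, LinearMap.zero_apply]))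
  have hu : ∀ c : k, IsUnit (θ - algebraMap k (Module.End k V) c) := fun c =>
    (Module.End.isUnit_iff _).mpr (hS _ (hmem c) (hne0 c))
  -- `θ` is transcendental
  have htr : Transcendental k θ := transcendental_of_forall_isUnit_sub_algebraMap θ hu
  -- the inverses `y c := (θ − c)⁻¹`
  let y : k → Module.End k V := fun c => (((hu c).unit⁻¹ : (Module.End k V)ˣ) : Module.End k V)
  have hy_mem : ∀ c, y c ∈ C := fun c => units_inv_mem_centralizer (hu c).unit (by rw [IsUnit.unit_spec]; exact hmem c)
  have hy_mul : ∀ c, (θ - algebraMap k (Module.End k V) c) * y c = 1 := fun c => (hu c).mul_val_inv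
  -- (a) linear independence of `y` in `End V`: Amitsur's lemma in the commutative subalgebra generated by `θ` and the `y c`
  have hc1 : ∀ c, Commute θ (y c) := fun c => by
    refine Commute.units_inv_right ?_
    rw [IsUnit.unit_spec]
    exact (Commute.refl θ).sub_right (Algebra.commutes c θ).symm
  have hc2 : ∀ c d, Commute (y c) (y d) := fun c d => by
    refine Commute.units_inv_right (Commute.units_inv_left ?_)
    rw [IsUnit.unit_spec, IsUnit.unit_spec]
    have ha : Commute (algebraMap k (Module.End k V) c) θ := Algebra.commutes c θ
    have hb : Commute θ (algebraMap k (Module.End k V) d) := (Algebra.commutes d θ).symm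
    have hab : Commute (algebraMap k (Module.End k V) c) (algebraMap k (Module.End k V) d) := Algebra.commutes c _
    exact ((Commute.refl θ).sub_right hb).sub_left (ha.sub_right hab)
  let T : Set (Module.End k V) := insert θ (Set.range y)
  have hcomm : ∀ p ∈ T, ∀ q ∈ T, p * q = q * p := by
    rintro p hp q hq
    rcases Set.mem_insert_iff.mp hp with rfl | ⟨c, rfl⟩ <;> rcases Set.mem_insert_iff.mp hq with rfl | ⟨d, rfl⟩
    · rfl
    · exact (hc1 d).eq
    · exact (hc1 c).eq.symm
    · exact (hc2 c d).eq
  let S : Subalgebra k (Module.End k V) := Algebra.adjoin k T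
  letI : CommRing S :=
    { (inferInstance : Ring S) with mul_comm := (Algebra.isMulCommutative_adjoin k hcomm).is_comm.comm }
  have hθS : θ ∈ S := Algebra.subset_adjoin (Set.mem_insert θ _)
  have hyS : ∀ c, y c ∈ S := fun c => Algebra.subset_adjoin (Set.mem_insert_of_mem θ ⟨c, rfl⟩)
  have Hx : Transcendental k (⟨θ, hθS⟩ : S) := Subalgebra.transcendental_iff_transcendental_val.mpr htr
  have hliS : LinearIndependent k (fun c : k => (⟨y c, hyS c⟩ : S)) :=
    Literature.RingTheory.JacobsonRadical.linearIndependent_of_sub_algebraMap_mul_eq_one Hx Function.injective_id fun c =>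
      Subtype.ext (by
        show (θ - algebraMap k (Module.End k V) c) * y c = 1
        exact hy_mul c)
  have hli : LinearIndependent k y := by
    have h := hliS.map' S.val.toLinearMap (LinearMap.ker_eq_bot.mpr Subtype.val_injective)
    exact h
  -- (b) linear independence of `c ↦ y c v₀` in `V`
  obtain ⟨v₀, hv₀⟩ := exists_ne (0 : V)
  have hdisj : Disjoint (Submodule.span k (Set.range y)) (LinearMap.ker (LinearMap.applyₗ (R := k) v₀)) := by
    rw [Submodule.disjoint_def]
    intro φ hφ hφ0
    rw [LinearMap.mem_ker, LinearMap.applyₗ_apply_apply] at hφ0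
    have hφC : φ ∈ C := by
      have hle : Submodule.span k (Set.range y) ≤ Subalgebra.toSubmodule C := by
        rw [Submodule.span_le]
        rintro _ ⟨c, rfl⟩
        exact hy_mem c
      exact hle hφ
    by_contra hφne
    exact hv₀ ((hS φ hφC hφne).1 (by rw [hφ0, map_zero]))
  have hliV : LinearIndependent k (fun c : k => y c v₀) := by
    have h := hli.map hdisj
    exact h
  -- (c) `|k| ≤ dim V`: contradiction
  have hle : Cardinal.lift.{uV} #k ≤ Cardinal.lift.{uk} (Module.rank k V) := hliV.cardinal_lift_le_rank
  exact (not_lt.mpr hle) hV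

end Dixmier

/-! ## §2 Irreducible `(𝔤, K)`-modules of dimension `< |ℂ|`: Schur's lemma without admissibility -/

-- Mathlib idiom (as in ★ `GKModules`, ★ `GKModulesSchur`): the commutator bracket on `Module.End ℂ V`, to MENTION `G.lie →ₗ⁅ℝ⁆ Module.End ℂ V`.
attribute [local instance 100] LieRing.ofAssociativeRing

section GK

variable {A : Type*} [NormedCommRing A] [NormedAlgebra ℝ A] [NormedAlgebra ℚ A] [CompleteSpace A]
  [StarRing A] {N : Type*} [Fintype N] [DecidableEq N] {G : RealMatrixGroup A N}
  {V : Type} [AddCommGroup V] [Module ℂ V]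
  (ρK : Representation ℂ G.maximalCompact V) (ρ𝔤 : G.lie →ₗ⁅ℝ⁆ Module.End ℂ V)

/-- The kernel of an operator commuting with `ρK(K)` and `ρ𝔤(𝔤)` is a `(𝔤, K)`-submodule. [cite: WallachRRG1, Lemma 3.3.2 (proof)] -/
theorem isGKSubmodule_ker_of_comm (T : Module.End ℂ V) (hTK : ∀ k : G.maximalCompact, ρK k ∘ₗ T = T ∘ₗ ρK k)
    (hT𝔤 : ∀ X : G.lie, ρ𝔤 X * T = T * ρ𝔤 X) : IsGKSubmodule ρK ρ𝔤 (LinearMap.ker T) := by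
  have h := isGKSubmodule_eigenspace_of_comm ρK ρ𝔤 T hTK hT𝔤 0
  rwa [Module.End.eigenspace_zero] at h

/-- The range of an operator commuting with `ρK(K)` and `ρ𝔤(𝔤)` is a `(𝔤, K)`-submodule. [cite: WallachRRG1, Lemma 3.3.2 (proof)] -/
theorem isGKSubmodule_range_of_comm (T : Module.End ℂ V) (hTK : ∀ k : G.maximalCompact, ρK k ∘ₗ T = T ∘ₗ ρK k)
    (hT𝔤 : ∀ X : G.lie, ρ𝔤 X * T = T * ρ𝔤 X) : IsGKSubmodule ρK ρ𝔤 (LinearMap.range T) := by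
  refine ⟨fun k w hw => ?_, fun X w hw => ?_⟩
  · obtain ⟨v, rfl⟩ := LinearMap.mem_range.mp hw
    have := LinearMap.congr_fun (hTK k) v
    simp only [LinearMap.coe_comp, Function.comp_apply] at this
    rw [this]
    exact LinearMap.mem_range_self T _
  · obtain ⟨v, rfl⟩ := LinearMap.mem_range.mp hw
    have := LinearMap.congr_fun (hT𝔤 X) v
    simp only [Module.End.mul_apply] at this
    rw [this]
    exact LinearMap.mem_range_self T _

/-- **Schur's dichotomy**: on an irreducible `(𝔤, K)`-module, every operator commuting with `ρK(K)` and `ρ𝔤(𝔤)` is `0` or bijective.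
[cite: WallachRRG1, Lemma 3.3.2] -/
theorem eq_zero_or_bijective_of_comm (hirr : IsIrreducibleGK ρK ρ𝔤) (T : Module.End ℂ V)
    (hTK : ∀ k : G.maximalCompact, ρK k ∘ₗ T = T ∘ₗ ρK k) (hT𝔤 : ∀ X : G.lie, ρ𝔤 X * T = T * ρ𝔤 X) :
    T = 0 ∨ Function.Bijective T := by
  rcases hirr.eq_bot_or_eq_top (isGKSubmodule_ker_of_comm ρK ρ𝔤 T hTK hT𝔤) with hk | hk
  · right
    refine ⟨LinearMap.ker_eq_bot.mp hk, ?_⟩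
    rcases hirr.eq_bot_or_eq_top (isGKSubmodule_range_of_comm ρK ρ𝔤 T hTK hT𝔤) with hr | hr
    · -- range `⊥` and kernel `⊥` on a non-zero module: impossible
      exfalso
      haveI := hirr.nontrivial
      obtain ⟨v, hv⟩ := exists_ne (0 : V)
      have hTv : T v = 0 := (Submodule.eq_bot_iff _).mp hr _ (LinearMap.mem_range_self T v)
      exact hv (LinearMap.ker_eq_bot.mp hk (by rw [hTv, map_zero]))
    · exact LinearMap.range_eq_top.mp hr
  · left
    exact LinearMap.ker_eq_top.mp hk

/-- **SCHUR–DIXMIER for irreducible `(𝔤, K)`-modules of countable dimension**: on an irreducible `(𝔤, K)`-module `V` with `dim_ℂ V ≤ ℵ₀`, every operator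
commuting with `ρK(K)` and `ρ𝔤(𝔤)` is a scalar — NO admissibility hypothesis. [cite: KnappVogan1995, Prop. A.12 (c), Prop. 4.87] [cite: WallachRRG1, 0.5.2] -/
theorem exists_eq_algebraMap_of_comm_of_rank_le_aleph0 (hirr : IsIrreducibleGK ρK ρ𝔤) (hrank : Module.rank ℂ V ≤ ℵ₀)
    (T : Module.End ℂ V) (hTK : ∀ k : G.maximalCompact, ρK k ∘ₗ T = T ∘ₗ ρK k) (hT𝔤 : ∀ X : G.lie, ρ𝔤 X * T = T * ρ𝔤 X) :
    ∃ c : ℂ, T = algebraMap ℂ (Module.End ℂ V) c := by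
  haveI := hirr.nontrivial
  -- the commutant of `ρK(K) ∪ ρ𝔤(𝔤)` and its Schur dichotomy
  let s : Set (Module.End ℂ V) := Set.range (fun k : G.maximalCompact => (ρK k : Module.End ℂ V)) ∪ Set.range (fun X : G.lie => ρ𝔤 X)
  have hcomm_of_mem : ∀ φ ∈ Subalgebra.centralizer ℂ s,
      (∀ k : G.maximalCompact, ρK k ∘ₗ φ = φ ∘ₗ ρK k) ∧ (∀ X : G.lie, ρ𝔤 X * φ = φ * ρ𝔤 X) := by
    intro φ hφ
    rw [Subalgebra.mem_centralizer_iff] at hφ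
    exact ⟨fun k => hφ _ (Or.inl ⟨k, rfl⟩), fun X => hφ _ (Or.inr ⟨X, rfl⟩)⟩
  have hS : ∀ φ ∈ Subalgebra.centralizer ℂ s, φ ≠ 0 → Function.Bijective φ := fun φ hφ hne =>
    ((eq_zero_or_bijective_of_comm ρK ρ𝔤 hirr φ (hcomm_of_mem φ hφ).1 (hcomm_of_mem φ hφ).2).resolve_left hne)
  have hT : T ∈ Subalgebra.centralizer ℂ s := by
    rw [Subalgebra.mem_centralizer_iff]
    rintro g (⟨k, rfl⟩ | ⟨X, rfl⟩)
    · exact hTK k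
    · exact hT𝔤 X
  have hV : Cardinal.lift.{0} (Module.rank ℂ V) < Cardinal.lift.{0} #ℂ := by
    rw [Cardinal.lift_id, Cardinal.lift_id, Cardinal.mk_complex]
    exact hrank.trans_lt Cardinal.aleph0_lt_continuum
  obtain ⟨c, hc⟩ := exists_hasEigenvalue_of_mem_centralizer_of_rank_lt hV hS hT
  rcases hirr.eq_bot_or_eq_top (isGKSubmodule_eigenspace_of_comm ρK ρ𝔤 T hTK hT𝔤 c) with h | h
  · exact absurd h (Module.End.hasEigenvalue_iff.mp hc)
  · refine ⟨c, LinearMap.ext fun w => ?_⟩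
    have hw : w ∈ T.eigenspace c := h ▸ Submodule.mem_top
    rw [Module.End.mem_eigenspace_iff] at hw
    rw [hw, Module.algebraMap_end_apply]


/-! ## §3 An irreducible `(𝔤, K)`-module has countable dimension -/

/-- `ρK k (ρ𝔤 X v) = ρ𝔤 (Ad k X) (ρK k v)` — the compatibility axiom ★ `IsGKModule.ad_compat` applied to a vector. [cite: WallachRRG1, §3.3.1] -/
theorem apply_ρ𝔤_eq_of_isGKModule [StarModule ℝ A] [ContinuousStar A] (hV : IsGKModule G ρK ρ𝔤) (k : G.maximalCompact) (X : G.lie) (v : V) :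
    ρK k (ρ𝔤 X v) = ρ𝔤 (G.Ad (Subgroup.inclusion G.maximalCompact_le_carrier k) X) (ρK k v) := by
  have h := LinearMap.congr_fun (hV.ad_compat k X) (ρK k v)
  simp only [LinearMap.coe_comp, Function.comp_apply] at h
  rw [← h]
  congr 1
  change ρ𝔤 X v = ρ𝔤 X ((ρK k⁻¹ * ρK k) v)
  rw [← map_mul, inv_mul_cancel, map_one, Module.End.one_apply]

/-- **AN IRREDUCIBLE `(𝔤, K)`-MODULE HAS COUNTABLE DIMENSION** (`dim 𝔤 < ∞`): it is spanned by the words `ρ𝔤(b_{i₁}) ⋯ ρ𝔤(b_{iₙ}) w_j` in a basis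
`(bᵢ)` of `𝔤` applied to a basis `(w_j)` of the (finite-dimensional) span `W₀` of one `K`-orbit — a countable set — because their span is a non-zero
`(𝔤, K)`-submodule (`𝔤`-stable by construction; `K`-stable by ★ `IsGKModule.ad_compat` and induction on the word, `W₀` being `K`-stable).
[cite: KnappVogan1995, Prop. 4.87 (proof)] [cite: WallachRRG1, 0.5.2, §3.3.1] -/
theorem rank_le_aleph0_of_isIrreducibleGK [StarModule ℝ A] [ContinuousStar A] [FiniteDimensional ℝ A]
    (hV : IsGKModule G ρK ρ𝔤) (hirr : IsIrreducibleGK ρK ρ𝔤) : Module.rank ℂ V ≤ ℵ₀ := by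
  classical
  haveI := hirr.nontrivial
  obtain ⟨v₀, hv₀⟩ := exists_ne (0 : V)
  -- the span `W₀` of the `K`-orbit of `v₀`: finite-dimensional and `K`-stable
  let W₀ : Submodule ℂ V := Submodule.span ℂ (Set.range fun k : G.maximalCompact => ρK k v₀)
  haveI : FiniteDimensional ℂ W₀ := hV.kFinite v₀
  have hW₀K : ∀ k, ∀ w ∈ W₀, ρK k w ∈ W₀ := by
    intro k w hw
    have hle : W₀.map (ρK k) ≤ W₀ := by
      rw [Submodule.map_span, Submodule.span_le]
      rintro _ ⟨_, ⟨k', rfl⟩, rfl⟩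
      exact Submodule.subset_span ⟨k * k', by simp [map_mul]⟩
    exact hle (Submodule.mem_map_of_mem hw)
  have hv₀W : v₀ ∈ W₀ := Submodule.subset_span ⟨1, by simp⟩
  -- a basis `w₀` of `W₀` (as vectors of `V`) and a basis `g` of `𝔤`
  let bW := Module.finBasis ℂ W₀
  let w₀ : Fin (Module.finrank ℂ W₀) → V := fun j => (bW j : V)
  have hW₀le : ∀ w ∈ W₀, w ∈ Submodule.span ℂ (Set.range w₀) := by
    intro w hw
    have h := bW.sum_repr ⟨w, hw⟩
    have h' := congrArg (fun y : W₀ => (y : V)) h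
    simp only [Submodule.coe_sum, Submodule.coe_smul] at h'
    rw [← h']
    exact Submodule.sum_mem _ fun j _ => Submodule.smul_mem _ _ (Submodule.subset_span ⟨j, rfl⟩)
  let bG := Module.finBasis ℝ G.lie.toSubmodule
  let g : Fin (Module.finrank ℝ G.lie.toSubmodule) → G.lie := fun i => ⟨(bG i : Matrix N N A), (bG i).2⟩
  -- `ρ𝔤 X = Σ_i cᵢ • ρ𝔤 (g i)` with `c = bG.repr X`
  let ι : G.lie.toSubmodule →ₗ[ℝ] G.lie :=
    { toFun := fun Z => ⟨(Z : Matrix N N A), Z.2⟩, map_add' := fun _ _ => rfl, map_smul' := fun _ _ => rfl }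
  have hρexp : ∀ X : G.lie, (ρ𝔤 X : Module.End ℂ V) = ∑ i, bG.repr ⟨X, X.2⟩ i • ρ𝔤 (g i) := by
    intro X
    have h := congrArg (fun Z => (ρ𝔤 : G.lie →ₗ⁅ℝ⁆ Module.End ℂ V).toLinearMap (ι Z)) (bG.sum_repr ⟨(X : Matrix N N A), X.2⟩)
    simp only [map_sum, map_smul, LieHom.coe_toLinearMap] at h
    exact h.symm
  -- the words
  let F : List (Fin (Module.finrank ℝ G.lie.toSubmodule)) × Fin (Module.finrank ℂ W₀) → V :=
    fun p => ((p.1.map fun i => (ρ𝔤 (g i) : Module.End ℂ V)).prod) (w₀ p.2)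
  have hFnil : ∀ j, F (([] : List (Fin (Module.finrank ℝ G.lie.toSubmodule))), j) = w₀ j := fun j => by
    simp only [F, List.map_nil, List.prod_nil, Module.End.one_apply]
  have hFcons : ∀ i l j, F (i :: l, j) = ρ𝔤 (g i) (F (l, j)) := fun i l j => by
    simp only [F, List.map_cons, List.prod_cons, Module.End.mul_apply]
  let S : Submodule ℂ V := Submodule.span ℂ (Set.range F)
  -- `W₀ ≤ S`
  have hW₀S : W₀ ≤ S := by
    intro w hw
    refine Submodule.span_mono ?_ (hW₀le w hw)
    rintro _ ⟨j, rfl⟩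
    exact ⟨([], j), hFnil j⟩
  -- `S` is `𝔤`-stable
  have hSg' : ∀ i, ∀ v ∈ S, ρ𝔤 (g i) v ∈ S := by
    intro i v hv
    refine Submodule.span_induction ?_ ?_ ?_ ?_ hv
    · rintro _ ⟨⟨l, j⟩, rfl⟩
      rw [← hFcons]
      exact Submodule.subset_span ⟨(i :: l, j), rfl⟩
    · rw [map_zero]
      exact S.zero_mem
    · intro x y _ _ hx hy
      rw [map_add]
      exact S.add_mem hx hy
    · intro c x _ hx
      rw [map_smul]
      exact S.smul_mem c hx
  have hSg : ∀ X : G.lie, ∀ v ∈ S, ρ𝔤 X v ∈ S := by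
    intro X v hv
    rw [hρexp X, LinearMap.sum_apply]
    refine S.sum_mem fun i _ => ?_
    rw [LinearMap.smul_apply]
    exact Submodule.smul_of_tower_mem S _ (hSg' i v hv)
  -- `S` is `K`-stable: induction on the word
  have hSK_gen : ∀ (l : List (Fin (Module.finrank ℝ G.lie.toSubmodule))) (j : Fin (Module.finrank ℂ W₀)) (k : G.maximalCompact),
      ρK k (F (l, j)) ∈ S := by
    intro l
    induction l with
    | nil =>
      intro j k
      rw [hFnil]
      exact hW₀S (hW₀K k _ (bW j).2)
    | cons i l ih =>
      intro j k
      rw [hFcons, apply_ρ𝔤_eq_of_isGKModule ρK ρ𝔤 hV]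
      exact hSg _ _ (ih j k)
  have hSK : ∀ (k : G.maximalCompact), ∀ v ∈ S, ρK k v ∈ S := by
    intro k v hv
    refine Submodule.span_induction ?_ ?_ ?_ ?_ hv
    · rintro _ ⟨⟨l, j⟩, rfl⟩
      exact hSK_gen l j k
    · rw [map_zero]
      exact S.zero_mem
    · intro x y _ _ hx hy
      rw [map_add]
      exact S.add_mem hx hy
    · intro c x _ hx
      rw [map_smul]
      exact S.smul_mem c hx
  -- hence `S = ⊤` (it contains `v₀ ≠ 0`)
  have hStop : S = ⊤ := by
    rcases hirr.eq_bot_or_eq_top ⟨hSK, hSg⟩ with h | h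
    · exfalso
      exact hv₀ ((Submodule.eq_bot_iff S).mp h v₀ (hW₀S hv₀W))
    · exact h
  -- and `dim V = dim S ≤ #(range F) ≤ #(words) ≤ ℵ₀`
  calc Module.rank ℂ V = Module.rank ℂ (⊤ : Submodule ℂ V) := (rank_top ℂ V).symm
    _ = Module.rank ℂ S := by rw [hStop]
    _ ≤ #(Set.range F) := rank_span_le _
    _ ≤ #(List (Fin (Module.finrank ℝ G.lie.toSubmodule)) × Fin (Module.finrank ℂ W₀)) := Cardinal.mk_range_le
    _ ≤ ℵ₀ := Cardinal.mk_le_aleph0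

/-! ## §4 Schur's lemma for irreducible `(𝔤, K)`-modules, no admissibility -/

variable {ρK ρ𝔤} in
/-- **SCHUR'S LEMMA WITHOUT ADMISSIBILITY** (= ★ `exists_eq_algebraMap_of_comm` with the hypothesis `hadm : IsAdmissibleGK ρK` DELETED): on an irreducible
`(𝔤, K)`-module (`dim 𝔤 < ∞`, carrier in `Type`), every operator commuting with `ρK(K)` and `ρ𝔤(𝔤)` is a scalar (Dixmier: §3 countable dimension + §2).
[cite: KnappVogan1995, Prop. A.12 (c), Prop. 4.87] [cite: WallachRRG1, 0.5.2, Lemma 3.3.2] -/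
theorem exists_eq_algebraMap_of_comm' [StarModule ℝ A] [ContinuousStar A] [FiniteDimensional ℝ A]
    (hV : IsGKModule G ρK ρ𝔤) (hirr : IsIrreducibleGK ρK ρ𝔤)
    (T : Module.End ℂ V) (hTK : ∀ k : G.maximalCompact, ρK k ∘ₗ T = T ∘ₗ ρK k) (hT𝔤 : ∀ X : G.lie, ρ𝔤 X * T = T * ρ𝔤 X) :
    ∃ c : ℂ, T = algebraMap ℂ (Module.End ℂ V) c :=
  exists_eq_algebraMap_of_comm_of_rank_le_aleph0 ρK ρ𝔤 hirr (rank_le_aleph0_of_isIrreducibleGK ρK ρ𝔤 hV hirr) T hTK hT𝔤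

variable {ρK ρ𝔤} in
/-- Pointwise form: `T v = c • v` for a unique scalar `c` (no admissibility). [cite: KnappVogan1995, Prop. 4.87] [cite: WallachRRG1, Lemma 3.3.2] -/
theorem existsUnique_forall_eq_smul_of_comm' [StarModule ℝ A] [ContinuousStar A] [FiniteDimensional ℝ A]
    (hV : IsGKModule G ρK ρ𝔤) (hirr : IsIrreducibleGK ρK ρ𝔤)
    (T : Module.End ℂ V) (hTK : ∀ k : G.maximalCompact, ρK k ∘ₗ T = T ∘ₗ ρK k) (hT𝔤 : ∀ X : G.lie, ρ𝔤 X * T = T * ρ𝔤 X) :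
    ∃! c : ℂ, ∀ v, T v = c • v := by
  haveI := hirr.nontrivial
  obtain ⟨c, hc⟩ := exists_eq_algebraMap_of_comm' hV hirr T hTK hT𝔤
  refine ⟨c, fun v => by rw [hc, Module.algebraMap_end_apply], fun c' hc' => ?_⟩
  obtain ⟨v, hv⟩ := exists_ne (0 : V)
  have h := hc' v
  rw [hc, Module.algebraMap_end_apply] at h
  exact (smul_left_injective ℂ hv h).symm

end GK


/-! ## §5 Read-backs: the Casimir of `U(α, β)` is a scalar on every irreducible `(𝔤, K)`-module and on the Harish-Chandra module of a unitary globalization -/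

section Casimir

open Literature.RepresentationTheory.BorelWallach2000
open Literature.RepresentationTheory.KonnoKonno2007 Literature.RepresentationTheory.KonnoKonno2007.RealDualPair

variable {α β : Type*} [Fintype α] [DecidableEq α] [Fintype β] [DecidableEq β]

/-- **Quasi-simplicity without admissibility**: the Casimir operator ★ `upqCasimirOp` of `U(α, β)` acts by a scalar on EVERY irreducible `(𝔤, K)`-module
(carrier in `Type`) — it commutes with `ρK(K)` (★ `upqCasimirOp_commK`) and `ρ𝔤(𝔤)` (★ `upqCasimirOp_comm𝔤`), and §4 applies.
[cite: Varadarajan1989, §5.4 (proof of Thm. 22: quasi-simplicity)] [cite: KnappVogan1995, Prop. 4.87] -/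
theorem upqCasimirOp_eq_algebraMap_of_isIrreducibleGK {V : Type} [AddCommGroup V] [Module ℂ V]
    {ρK : Representation ℂ (uFormGroup α β).maximalCompact V} {ρ𝔤 : (uFormGroup α β).lie →ₗ⁅ℝ⁆ Module.End ℂ V}
    (hV : IsGKModule (uFormGroup α β) ρK ρ𝔤) (hirr : IsIrreducibleGK ρK ρ𝔤) :
    ∃ c : ℂ, upqCasimirOp ρ𝔤 = algebraMap ℂ (Module.End ℂ V) c :=
  exists_eq_algebraMap_of_comm' hV hirr _ (fun k => (upqCasimirOp_commK ρK ρ𝔤 hV.ad_compat k).symm) fun X => by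
    rw [Module.End.mul_eq_comp, Module.End.mul_eq_comp]
    exact (upqCasimirOp_comm𝔤 ρ𝔤 X).symm

/-- **The Casimir acts by a scalar on the Harish-Chandra module of a unitary globalization of an irreducible class** — the quasi-simplicity input of
the V19 road, with NO admissibility (★ `IsUnitaryGlobalization.isIrreducibleGK_harishChandra`, ★ `isGKModule_harishChandra_holds`, §4).
[cite: Varadarajan1989, §5.4 (proof of Thm. 22)] [cite: KnappVogan1995, Prop. 4.87] -/
theorem exists_upqCasimirOp_harishChandra_eq_smul {x : GKIrrClass (uFormGroup α β)}
    {E : Type} [NormedAddCommGroup E] [InnerProductSpace ℂ E] [CompleteSpace E]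
    {ϖ : ContRepresentation ℂ (uFormGroup α β).carrier E} (hϖ : IsUnitaryGlobalization (uFormGroup α β) x ϖ) :
    ∃ c : ℂ, ∀ v : harishChandraSpace (uFormGroup α β) ϖ,
      upqCasimirOp (harishChandraRepLie (uFormGroup α β) ϖ hϖ.isStronglyContinuous) v = c • v := by
  have hV : IsGKModule (uFormGroup α β) (harishChandraRepK (uFormGroup α β) ϖ)
      (harishChandraRepLie (uFormGroup α β) ϖ hϖ.isStronglyContinuous) :=
    isGKModule_harishChandra_holds (uFormGroup α β) ϖ hϖ.isStronglyContinuous (harishChandraRepK (uFormGroup α β) ϖ)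
      (fun _ _ => rfl) (isHarishChandraModuleOf_harishChandraRepLie (uFormGroup α β) ϖ hϖ.isStronglyContinuous)
  obtain ⟨c, hc⟩ := upqCasimirOp_eq_algebraMap_of_isIrreducibleGK hV (hϖ.isIrreducibleGK_harishChandra (uFormGroup α β))
  exact ⟨c, fun v => by rw [hc, Module.algebraMap_end_apply]⟩

end Casimir

end Literature.NumberTheory.Automorphic

end
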